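import Literature.NumberTheory.EllipticCurves.NonvanishingTwistsPrescribedSplittingOfHoffsteinLuoProofs
import Literature.NumberTheory.EllipticCurves.RootNumberEvenAnalyticRankProofs
import Summits.BirchSwinnertonDyer.Rank1Residual.X12.CMSevenAwayFromSeven

/-!
# Cuspidal descent on 𝒞₇ — THEOREM A (the admissible Heegner field) is a TREE THEOREM

Crux `stmt-BirchSwinnertonDyer-19945` (`RamifiedSevenEllipticUnits.EllipticUnitValueSevenOfGZK`), crux
idea `cuspidal-descent-kolyvagin-nonvanishing` (card REV 19), memo `CuspidalDescentUniformP1-g42.md`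
THEOREM A, memo `CuspidalDescentSupply-g43.md`. No summit statement is proved here; crux 19945
remains OPEN. This file is a CERTIFICATE (it elaborates against the tree; 0 sorries; it introduces no
definition and no named fact), not a line and not a skeleton (W-79).

WHAT IS CERTIFIED. THEOREM A of memo g42-P1 — «for every member `W = E_D` of 𝒞₇ and every bound `B`
there is an imaginary quadratic `K″`, `d_{K″} ≡ 1 (mod 8)`, `|d_{K″}| > B`, with `7`, `2` and every
prime of `N(W)` split in `K″` and `L(W^{(d_{K″})}, 1) ≠ 0`» — is ONE APPLICATION of theorems already in
the tree (`NonvanishingTwistsPrescribedSplitting*.lean`, 2026-08-27), modulo exactly two binders: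

* `hmod : exists_isNewformOf` (Modularity, BCDT 2001 Thm. A) — used ONLY to read `w(W) = −1` off the
  clause `analyticRank W = 1` of `ClassCSeven`
  (`WeierstrassCurve.rootNumber_eq_neg_one_pow_analyticRank_of_exists_isNewformOf`);
* `hFH : friedbergHoffstein_exists_heegnerField_splitDivisors_twist_ne_zero` — Friedberg–Hoffstein
  1995, Thm. B in the finite-set split form (named fact of the tree), applied with auxiliary integer
  `M = 2·7` through the tree's consumer shape `exists_heegnerField_split_two_split_oddDiscr_twist_ne_zero`.

No splitting-at-`D` condition, no square-conductor remark, no class-number / Bernoulli clause and no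
per-member hypothesis enter: `ClassCSeven.exists_admissibleHeegnerField`.

LITERATURE STATUS OF `hFH` (the point of this file; card REV 19 row P1*). The tree gives `hFH`
THREE roads, all typed:
(FH) by name — Friedberg–Hoffstein, Ann. of Math. 142 (1995), Thm. B: a COMPLETE proof in print;
(HL) `friedbergHoffstein_exists_heegnerField_splitDivisors_twist_ne_zero_of_hoffsteinLuo hmod hHL`
     from `HoffsteinLuo1997_exists_twist_L_one_ne_zero` (whose `≤ 4`-prime-factor clause is never
     used: `…_of_twists`, `…_of_card_le r`);
(RS) `…_of_card_le 20 hmod (HoffsteinLuo1997.forall_exists_twist_card_le_twenty_of_RS2015_prop2 hpos hRS2)`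
     from Guo 1996 positivity `re_entireLFunction_one_nonneg` and Radziwiłł–Soundararajan 2015 §2
     Prop. 2 TRANSCRIBED (module `NonvanishingTwistsHoffsteinLuoMomentProofs`, complete in print;
     that module is not imported here — the corollary `…_of_card_le` below takes its conclusion as
     the binder `hr`, so the RS road is one application away).
Hence the card's residual «HL97 cite-only» (REV 18) becomes «FH 1995 Thm. B (complete in print,
named fact) ∨ HL 1997 + BCDT ∨ RS 2015 Prop. 2 + Guo 1996 + BCDT (complete in print, transcribed)».

[cite: FriedbergHoffstein1995, Thm. B] [cite: HoffsteinLuo1997, Theorem (§1, pp. 435–436)]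
[cite: RadziwillSoundararajan2015, §2 Proposition 2] [cite: MurtyMurty1997, Ch. 6 §1, p. 96]
[cite: BCDTJAMS2001, Thm. A] [cite: JetchevSkinnerWan2017, §7.4.1 (p. 30)]
-/

noncomputable section

set_option linter.dupNamespace false

open scoped Classical

open WeierstrassCurve Literature Literature.NumberTheory.EllipticCurves
  Literature.NumberTheory.EllipticCurves.ModularForms
  Summit.BirchSwinnertonDyer.Rank1Residual Summit.BirchSwinnertonDyer.Rank1Residual.X12

namespace Summit.BirchSwinnertonDyer.BirchSwinnertonDyer.Cruxes.EllipticUnitValueSevenOfGZK.CuspidalDescent.HeegnerFieldSupply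

/-! ## §1 The sign of a 𝒞₇ curve -/

/-- A 𝒞₇ curve has root number `−1`: analytic rank `1` is a clause of `ClassCSeven`, parity from
modularity. [cite: BCDTJAMS2001, Thm. A] [cite: SilvermanAEC2009, C.16 Thm. 16.3] -/
theorem rootNumber_eq_neg_one_of_classCSeven (hmod : exists_isNewformOf) {W : WeierstrassCurve ℚ}
    [W.IsElliptic] [W.IsGloballyMinimal] (h : ClassCSeven W) : W.rootNumber = -1 := by
  have hw := W.rootNumber_eq_neg_one_pow_analyticRank_of_exists_isNewformOf hmod
  rw [h.2.2.1] at hw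
  simpa using hw

/-! ## §2 THEOREM A on 𝒞₇ from the Friedberg–Hoffstein named fact -/

/-- **THEOREM A (memo g42-P1) as a tree theorem.** For every `W ∈ 𝒞₇` and every bound `B` there is
an imaginary quadratic `K″` with `|d_{K″}| > B`, every prime of `N(W)` split in `K″` (Heegner
hypothesis for `N(W) = 49 D²`), `7` split, `2` split, hence `d_{K″} ≡ 1 (mod 8)` and
`(d_{K″}/7) = +1`, `(d_{K″}/q) = +1` for every odd prime `q ∣ N(W)`, and `L(W^{(d_{K″})}, 1) ≠ 0`
(so `W/K″` has analytic rank `1` and the twin `W^{(d_{K″})}` analytic rank `0`). One application of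
`exists_heegnerField_split_two_split_oddDiscr_twist_ne_zero` at the prime `7`, the Kronecker clauses
by `SatisfiesHeegnerHypothesis.discr_emod_eight` / `.jacobiSym_discr_eq_one`.
[cite: FriedbergHoffstein1995, Thm. B] [cite: JetchevSkinnerWan2017, §7.4.1 (p. 30)] -/
theorem ClassCSeven.exists_admissibleHeegnerField
    (hFH : friedbergHoffstein_exists_heegnerField_splitDivisors_twist_ne_zero)
    (hmod : exists_isNewformOf) {W : WeierstrassCurve ℚ} [W.IsElliptic] [W.IsGloballyMinimal]
    (h : ClassCSeven W)
    (B : ℕ) :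
    ∃ (K : Type) (_ : Field K) (_ : NumberField K), IsImaginaryQuadratic K ∧
      B < (NumberField.discr K).natAbs ∧
      SatisfiesHeegnerHypothesis (W.conductorNorm ℤ) K ∧ SatisfiesHeegnerHypothesis 7 K ∧
      SatisfiesHeegnerHypothesis 2 K ∧ NumberField.discr K % 8 = 1 ∧
      jacobiSym (NumberField.discr K) 7 = 1 ∧
      (∀ q : ℕ, q.Prime → q ∣ W.conductorNorm ℤ → q ≠ 2 → jacobiSym (NumberField.discr K) q = 1) ∧
        (W.quadraticTwist (NumberField.discr K : ℚ)).entireLFunction 1 ≠ 0 := by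
  obtain ⟨K, hF, hN, hK, hB, hHN, hH7, hH2, -, hL⟩ :=
    exists_heegnerField_split_two_split_oddDiscr_twist_ne_zero hFH W
      (rootNumber_eq_neg_one_of_classCSeven hmod h) Nat.prime_seven B
  exact ⟨K, hF, hN, hK, hB, hHN, hH7, hH2,
    SatisfiesHeegnerHypothesis.discr_emod_eight hK.1 hH2 (dvd_refl 2),
    SatisfiesHeegnerHypothesis.jacobiSym_discr_eq_one hK.1 hH7 Nat.prime_seven (dvd_refl 7)
      (by norm_num),
    fun q hq hqN hq2 ↦ SatisfiesHeegnerHypothesis.jacobiSym_discr_eq_one hK.1 hHN hq hqN hq2, hL⟩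

/-! ## §3 The same along the Hoffstein–Luo road, any count-free supply, and the RS road -/

/-- THEOREM A from Modularity and Hoffstein–Luo 1997 (road (HL); the form of memo g42-P1 §2; the
`≤ 4`-prime-factor clause of Hoffstein–Luo is discarded by the tree's `…_of_card_le 4`).
[cite: HoffsteinLuo1997, Theorem (§1, pp. 435–436)] [cite: MurtyMurty1997, Ch. 6 §1, p. 96] -/
theorem ClassCSeven.exists_admissibleHeegnerField_of_hoffsteinLuo (hmod : exists_isNewformOf)
    (hHL : HoffsteinLuo1997_exists_twist_L_one_ne_zero) {W : WeierstrassCurve ℚ} [W.IsElliptic]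
    [W.IsGloballyMinimal] (h : ClassCSeven W) (B : ℕ) :
    ∃ (K : Type) (_ : Field K) (_ : NumberField K), IsImaginaryQuadratic K ∧
      B < (NumberField.discr K).natAbs ∧
      SatisfiesHeegnerHypothesis (W.conductorNorm ℤ) K ∧ SatisfiesHeegnerHypothesis 7 K ∧
      SatisfiesHeegnerHypothesis 2 K ∧ NumberField.discr K % 8 = 1 ∧
      jacobiSym (NumberField.discr K) 7 = 1 ∧
      (∀ q : ℕ, q.Prime → q ∣ W.conductorNorm ℤ → q ≠ 2 → jacobiSym (NumberField.discr K) q = 1) ∧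
        (W.quadraticTwist (NumberField.discr K : ℚ)).entireLFunction 1 ≠ 0 :=
  ClassCSeven.exists_admissibleHeegnerField
    (friedbergHoffstein_exists_heegnerField_splitDivisors_twist_ne_zero_of_hoffsteinLuo hmod hHL)
    hmod h B

/-- THEOREM A from Modularity and ANY count-free supply of non-vanishing twists with prescribed
residue symbols `+1` (the tree's `…_of_twists`: no bound on `ω(d)` is ever used by the chain).
[cite: HoffsteinLuo1997, Theorem (§1, pp. 435–436)] [cite: FriedbergHoffstein1995, Thm. B] -/
theorem ClassCSeven.exists_admissibleHeegnerField_of_twists (hmod : exists_isNewformOf)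
    (hTw : ∀ (W : WeierstrassCurve ℚ) [W.IsElliptic] (S : Finset ℕ) (B : ℕ),
      ∃ d : ℤ, B < d.natAbs ∧ Squarefree d ∧ d % 8 = 1 ∧
        (∀ p ∈ S, p.Prime → p ≠ 2 → jacobiSym d p = 1) ∧
          (W.quadraticTwist (d : ℚ)).entireLFunction 1 ≠ 0)
    {W : WeierstrassCurve ℚ} [W.IsElliptic] [W.IsGloballyMinimal]
    (h : ClassCSeven W) (B : ℕ) :
    ∃ (K : Type) (_ : Field K) (_ : NumberField K), IsImaginaryQuadratic K ∧
      B < (NumberField.discr K).natAbs ∧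
      SatisfiesHeegnerHypothesis (W.conductorNorm ℤ) K ∧ SatisfiesHeegnerHypothesis 7 K ∧
      SatisfiesHeegnerHypothesis 2 K ∧ NumberField.discr K % 8 = 1 ∧
      jacobiSym (NumberField.discr K) 7 = 1 ∧
      (∀ q : ℕ, q.Prime → q ∣ W.conductorNorm ℤ → q ≠ 2 → jacobiSym (NumberField.discr K) q = 1) ∧
        (W.quadraticTwist (NumberField.discr K : ℚ)).entireLFunction 1 ≠ 0 :=
  ClassCSeven.exists_admissibleHeegnerField
    (friedbergHoffstein_exists_heegnerField_splitDivisors_twist_ne_zero_of_twists hmod hTw) hmod h B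

/-- THEOREM A from Modularity and a Hoffstein–Luo-shaped supply with ANY bound `r` on `ω(d)`.
With `r = 20` and
`hr := HoffsteinLuo1997.forall_exists_twist_card_le_twenty_of_RS2015_prop2 hpos hRS2`
(module `Literature.NumberTheory.EllipticCurves.NonvanishingTwistsHoffsteinLuoMomentProofs`;
`hpos : WeierstrassCurve.re_entireLFunction_one_nonneg` = Guo 1996 / Waldspurger positivity,
`hRS2` = Radziwiłł–Soundararajan 2015 §2 Prop. 2 transcribed) this is road (RS): every input has a
complete proof in print. [cite: RadziwillSoundararajan2015, §2 Proposition 2]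
[cite: Guo1996, Thm. 1] [cite: HoffsteinLuo1997, Theorem (§1, pp. 435–436)] -/
theorem ClassCSeven.exists_admissibleHeegnerField_of_card_le (r : ℕ) (hmod : exists_isNewformOf)
    (hr : ∀ (W : WeierstrassCurve ℚ) [W.IsElliptic] (S : Finset ℕ) (Bd : ℕ),
      ∃ d : ℤ, Bd < d.natAbs ∧ Squarefree d ∧ d % 8 = 1 ∧ d.natAbs.primeFactors.card ≤ r ∧
        (∀ p ∈ S, p.Prime → p ≠ 2 → jacobiSym d p = 1) ∧
          (W.quadraticTwist (d : ℚ)).entireLFunction 1 ≠ 0)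
    {W : WeierstrassCurve ℚ} [W.IsElliptic] [W.IsGloballyMinimal]
    (h : ClassCSeven W) (B : ℕ) :
    ∃ (K : Type) (_ : Field K) (_ : NumberField K), IsImaginaryQuadratic K ∧
      B < (NumberField.discr K).natAbs ∧
      SatisfiesHeegnerHypothesis (W.conductorNorm ℤ) K ∧ SatisfiesHeegnerHypothesis 7 K ∧
      SatisfiesHeegnerHypothesis 2 K ∧ NumberField.discr K % 8 = 1 ∧
      jacobiSym (NumberField.discr K) 7 = 1 ∧
      (∀ q : ℕ, q.Prime → q ∣ W.conductorNorm ℤ → q ≠ 2 → jacobiSym (NumberField.discr K) q = 1) ∧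
        (W.quadraticTwist (NumberField.discr K : ℚ)).entireLFunction 1 ≠ 0 :=
  ClassCSeven.exists_admissibleHeegnerField
    (friedbergHoffstein_exists_heegnerField_splitDivisors_twist_ne_zero_of_card_le r hmod hr) hmod h B

/-! ## §4 The discriminant form (clauses (a)–(d) of memo g42-P1 §2, literally) -/

/-- THEOREM A in discriminant form along ANY count-free supply: a square-free `d″ < 0`,
`d″ ≡ 1 (mod 8)`, `|d″| > B`, `(d″/7) = 1`, `(d″/q) = 1` for every odd prime `q ∣ N(W)`, and
`L(W^{(d″)}, 1) ≠ 0` — the tree's count-free sign obstruction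
`exists_neg_fundamental_twist_ne_zero_of_twists` (Murty–Murty 1997 Ch. 6 §1: for `w(W) = −1` a
positive such `d` would give `L(W^{(d)}, 1) = 0`) at `S = {7}`.
[cite: MurtyMurty1997, Ch. 6 §1, p. 96] [cite: HoffsteinLuo1997, Theorem (§1, pp. 435–436)] -/
theorem ClassCSeven.exists_admissible_discr_of_twists (hmod : exists_isNewformOf)
    (hTw : ∀ (W : WeierstrassCurve ℚ) [W.IsElliptic] (S : Finset ℕ) (B : ℕ),
      ∃ d : ℤ, B < d.natAbs ∧ Squarefree d ∧ d % 8 = 1 ∧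
        (∀ p ∈ S, p.Prime → p ≠ 2 → jacobiSym d p = 1) ∧
          (W.quadraticTwist (d : ℚ)).entireLFunction 1 ≠ 0)
    {W : WeierstrassCurve ℚ} [W.IsElliptic] [W.IsGloballyMinimal]
    (h : ClassCSeven W) (B : ℕ) :
    ∃ d : ℤ, d < 0 ∧ Squarefree d ∧ d % 8 = 1 ∧ B < d.natAbs ∧ jacobiSym d 7 = 1 ∧
      (∀ q : ℕ, q.Prime → q ∣ W.conductorNorm ℤ → q ≠ 2 → jacobiSym d q = 1) ∧
      (W.quadraticTwist (d : ℚ)).entireLFunction 1 ≠ 0 := by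
  obtain ⟨d, hdneg, hsq, hd8, hB, hjacS, hjacN, hL⟩ :=
    exists_neg_fundamental_twist_ne_zero_of_twists hmod hTw W
      (rootNumber_eq_neg_one_of_classCSeven hmod h) {7} B
  exact ⟨d, hdneg, hsq, hd8, hB, hjacS 7 (Finset.mem_singleton_self 7) Nat.prime_seven (by norm_num),
    hjacN, hL⟩

/-- The discriminant form along road (HL). [cite: HoffsteinLuo1997, Theorem (§1, pp. 435–436)] -/
theorem ClassCSeven.exists_admissible_discr_of_hoffsteinLuo (hmod : exists_isNewformOf)
    (hHL : HoffsteinLuo1997_exists_twist_L_one_ne_zero) {W : WeierstrassCurve ℚ} [W.IsElliptic]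
    [W.IsGloballyMinimal] (h : ClassCSeven W) (B : ℕ) :
    ∃ d : ℤ, d < 0 ∧ Squarefree d ∧ d % 8 = 1 ∧ B < d.natAbs ∧ jacobiSym d 7 = 1 ∧
      (∀ q : ℕ, q.Prime → q ∣ W.conductorNorm ℤ → q ≠ 2 → jacobiSym d q = 1) ∧
      (W.quadraticTwist (d : ℚ)).entireLFunction 1 ≠ 0 :=
  ClassCSeven.exists_admissible_discr_of_twists hmod
    (fun W _ S B ↦ by
      obtain ⟨d, hBd, hsq, hd8, -, hjac, hL⟩ := hHL W S B
      exact ⟨d, hBd, hsq, hd8, hjac, hL⟩) h B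

end Summit.BirchSwinnertonDyer.BirchSwinnertonDyer.Cruxes.EllipticUnitValueSevenOfGZK.CuspidalDescent.HeegnerFieldSupply

end
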